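import Summits.NavierStokesRegularity.NavierStokesRegularity.Theorems.ThreadingFluxCentreVirialHodgePointwise
import HarnessLib

/-!
# Hodge slaving, sphere-free — III: the weighted Bochner inequality

★ `weighted_bochner_ineq`: for `W ∈ C²(ℝ³; ℝ³)` tangential about `x₀` and unthreaded off `x₀`, and every nonnegative `C¹`
radial weight `κ` of the squared radius vanishing near `0` and far out,
`∫ κ(|y|²) |W|²/|y|² ≤ ½ ∫ κ(|y|²) (div W)²`.  Proof: `∫ div(κ(|y|²) Q) = 0` (whole-space Gauss–Green, tree
`integral_divergence_eq_zero`) where `Q` is the tangential Bochner field — the `κ′` term dies on tangentiality — plus the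
pointwise inequality of part II; the singularity at the centre is handled by the gluing lemma `contDiff_smul_of_vanishing`
(a `Cⁿ` factor vanishing on a ball about `x₀` times a field `Cⁿ` off `x₀` is `Cⁿ`).

Part of the sphere-free proof of HODGE SLAVING FOR `C²` FIELDS (H′) behind ★ T2 `PoloidalTameLiouville` of the
centre-virial card (ns-idea-15 g9; twin `ThreadingFluxCentreVirialDefs`).  Folklore differential geometry / linear algebra,
re-derived in ambient coordinates; information-grade; W1 movement 0; `PoloidalLiouville` (1222), T0, Galdi's problem OPEN;
NS regularity is NOT proved.  `--supports stmt-NavierStokesRegularity-1222 --as helper`.  Filed by ns-wall-eng-4 g6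
(cell ns-wall-extremal).
[cite: KorobkovPileckasRusso2015, Thm 3.6]
-/

-- the summit and its single sub-problem share the name (CONVENTIONS §1)
set_option linter.dupNamespace false

noncomputable section

namespace Summit.NavierStokesRegularity.NavierStokesRegularity.Theorems.PoloidalLiouville.CentreVirial

open Set Function MeasureTheory Filter Topology
open Literature.Analysis.FluidPDE
open Literature.Analysis.FluidPDE.VectorCalculus (divergence)
open Summit.NavierStokesRegularity.NavierStokesRegularity.Theorems.PoloidalLiouville.CentreJet (E3)
open scoped RealInnerProductSpace

namespace Hodge

/-! ### Gluing at the centre -/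

/-- A `Cⁿ` scalar factor vanishing on a ball about `x₀` times a field that is `Cⁿ` off `x₀` is `Cⁿ` everywhere. -/
theorem contDiff_smul_of_vanishing {F : Type*} [NormedAddCommGroup F] [NormedSpace ℝ F] {n : WithTop ℕ∞}
    {g : E3 → ℝ} {f : E3 → F} {x₀ : E3} {ρ : ℝ} (hρ : 0 < ρ) (hg : ContDiff ℝ n g)
    (hg0 : ∀ x ∈ Metric.ball x₀ ρ, g x = 0) (hf : ContDiffOn ℝ n f {x₀}ᶜ) :
    ContDiff ℝ n fun x => g x • f x := by
  rw [contDiff_iff_contDiffAt]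
  intro x
  by_cases hx : x = x₀
  · subst hx
    have hev : (fun z => g z • f z) =ᶠ[nhds x] fun _ => (0 : F) :=
      Filter.eventuallyEq_of_mem (Metric.ball_mem_nhds x hρ) fun z hz => by
        simp only [hg0 z hz, zero_smul]
    exact (contDiffAt_const (c := (0 : F))).congr_of_eventuallyEq hev
  · exact hg.contDiffAt.smul (hf.contDiffAt (isOpen_compl_singleton.mem_nhds hx))

/-- The radial profile `x ↦ κ(|x − x₀|²)` vanishes on the ball of radius `√α₀` when `κ` vanishes on `(-∞, α₀]`. -/
theorem radialProfile_eq_zero_of_mem_ball {κ : ℝ → ℝ} {α₀ : ℝ} (hκ0 : ∀ σ, σ ≤ α₀ → κ σ = 0) {x₀ x : E3}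
    (hx : x ∈ Metric.ball x₀ (Real.sqrt α₀)) : κ (‖x - x₀‖ ^ 2) = 0 := by
  apply hκ0
  rw [Metric.mem_ball, dist_eq_norm] at hx
  have h0 : 0 ≤ ‖x - x₀‖ := norm_nonneg _
  have hα : 0 < Real.sqrt α₀ := lt_of_le_of_lt h0 hx
  have hα' : 0 < α₀ := Real.sqrt_pos.1 hα
  have := Real.lt_sqrt h0 |>.1 hx
  exact this.le

/-- The Bochner field of a `C²` field is `C¹` off the centre. -/
theorem contDiffOn_bochnerField {W : E3 → E3} (hW : ContDiff ℝ 2 W) (x₀ : E3) :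
    ContDiffOn ℝ 1 (bochnerField x₀ W) {x₀}ᶜ := by
  have hW1 : ContDiff ℝ 1 W := hW.of_le (by norm_num)
  have hDW : ContDiff ℝ 1 (fderiv ℝ W) := hW.fderiv_right (m := 1) le_rfl
  have hdiv : ContDiff ℝ 1 (divergence W) := by
    have h : divergence W = (traceCLM : (E3 →L[ℝ] E3) →L[ℝ] ℝ) ∘ fderiv ℝ W := funext (divergence_eq_traceCLM W)
    rw [h]
    exact traceCLM.contDiff.comp hDW
  have hconv : ContDiff ℝ 1 (convect W W) := by
    have hc : convect W W = fun y => (fderiv ℝ W y) (W y) := rfl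
    rw [hc]
    exact hDW.clm_apply hW1
  have hns : ContDiff ℝ 1 fun z : E3 => ‖z - x₀‖ ^ 2 := (contDiff_id.sub contDiff_const).norm_sq ℝ
  have hinv : ContDiffOn ℝ 1 (fun z : E3 => (‖z - x₀‖ ^ 2)⁻¹) {x₀}ᶜ := by
    refine hns.contDiffOn.inv fun z hz => ?_
    exact pow_ne_zero 2 (norm_ne_zero_iff.2 (sub_ne_zero.2 hz))
  have hθ : ContDiffOn ℝ 1 (fun z : E3 => (‖z - x₀‖ ^ 2)⁻¹ * ‖W z‖ ^ 2) {x₀}ᶜ :=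
    hinv.mul (hW1.norm_sq ℝ).contDiffOn
  unfold bochnerField
  exact ((hdiv.smul hW1).sub hconv).contDiffOn.sub (hθ.smul (contDiff_id.sub contDiff_const).contDiffOn)

/-- ★ **The weighted Bochner inequality.**  For `W ∈ C²(ℝ³; ℝ³)` tangential about `x₀` and unthreaded off `x₀`, and a
nonnegative `C¹` radial weight `κ` of the squared radius vanishing near `0` and far out:
`∫ κ(|y|²) |W|²/|y|² ≤ ½ ∫ κ(|y|²) (div W)²`.  (Sphere-wise this is `∮|v|² ≤ (r²/2)∮(div_S v)²` for curl-free
tangential `v` — Hodge/Poincaré with the sharp `λ₁(S²) = 2` — obtained here WITHOUT surface measures: `∫ div(κ(|y|²) Q) = 0`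
for the tangential Bochner field `Q`, plus the pointwise inequality `div Q + |W|²/|y|² ≤ ½(div W)²`.) -/
theorem weighted_bochner_ineq {W : E3 → E3} {x₀ : E3} (hW : ContDiff ℝ 2 W) (htan : ∀ z, ⟪W z, z - x₀⟫ = 0)
    (hcurl : ∀ z, z ≠ x₀ → ⟪curl W z, z - x₀⟫ = 0) {κ : ℝ → ℝ} (hκ : ContDiff ℝ 1 κ) {α₀ S : ℝ}
    (hα₀ : 0 < α₀) (hκ0 : ∀ σ, σ ≤ α₀ → κ σ = 0) (hκS : ∀ σ, S ≤ σ → κ σ = 0) (hκnn : ∀ σ, 0 ≤ κ σ) :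
    ∫ x, κ (‖x - x₀‖ ^ 2) * (‖W x‖ ^ 2 / ‖x - x₀‖ ^ 2) ≤
      (1 / 2) * ∫ x, κ (‖x - x₀‖ ^ 2) * divergence W x ^ 2 := by
  set g : E3 → ℝ := fun x => κ (‖x - x₀‖ ^ 2) with hg_def
  have hns : ContDiff ℝ 1 fun z : E3 => ‖z - x₀‖ ^ 2 := (contDiff_id.sub contDiff_const).norm_sq ℝ
  have hg : ContDiff ℝ 1 g := hκ.comp hns
  have hρ : 0 < Real.sqrt α₀ := Real.sqrt_pos.2 hα₀
  have hg0 : ∀ x ∈ Metric.ball x₀ (Real.sqrt α₀), g x = 0 := fun x hx => radialProfile_eq_zero_of_mem_ball hκ0 hx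
  have hQ : ContDiffOn ℝ 1 (bochnerField x₀ W) {x₀}ᶜ := contDiffOn_bochnerField hW x₀
  -- the test field
  set V : E3 → E3 := fun x => g x • bochnerField x₀ W x with hV_def
  have hV : ContDiff ℝ 1 V := contDiff_smul_of_vanishing hρ hg hg0 hQ
  have hVc : HasCompactSupport V := by
    refine HasCompactSupport.intro (isCompact_closedBall x₀ (|S| + 1)) fun x hx => ?_
    rw [Metric.mem_closedBall, dist_eq_norm, not_le] at hx
    have h1 : 1 ≤ ‖x - x₀‖ := by linarith [abs_nonneg S]
    have hS' : S ≤ ‖x - x₀‖ ^ 2 := by nlinarith [le_abs_self S]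
    show g x • bochnerField x₀ W x = 0
    rw [hg_def]; dsimp only
    rw [hκS _ hS', zero_smul]
  have hint0 := integral_divergence_eq_zero hV hVc
  -- `div V = g · div Q` everywhere
  have hgrad : ∀ x, gradient g x = (2 * deriv κ (‖x - x₀‖ ^ 2)) • (x - x₀) := by
    intro x
    have h1 : HasFDerivAt (fun x : E3 => x - x₀) (ContinuousLinearMap.id ℝ E3) x := (hasFDerivAt_id x).sub_const x₀
    have h2 := h1.norm_sq
    have h3 : HasDerivAt κ (deriv κ (‖x - x₀‖ ^ 2)) (‖x - x₀‖ ^ 2) := (hκ.differentiable one_ne_zero _).hasDerivAt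
    have h4 := h3.comp_hasFDerivAt x h2
    have e : g = κ ∘ fun x : E3 => ‖x - x₀‖ ^ 2 := rfl
    rw [gradient, e, h4.fderiv]
    apply (InnerProductSpace.toDual ℝ E3).injective
    rw [LinearIsometryEquiv.apply_symm_apply]
    ext h
    simp only [_root_.FunLike.coe_smul, Pi.smul_apply, ContinuousLinearMap.comp_apply, ContinuousLinearMap.id_apply,
      innerSL_apply_apply, smul_eq_mul, InnerProductSpace.toDual_apply_apply, real_inner_smul_left]
    ring
  have hdivV : ∀ x, divergence V x = g x * divergence (bochnerField x₀ W) x := by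
    intro x
    by_cases hx : x = x₀
    · subst hx
      have hev : V =ᶠ[nhds x] fun _ => (0 : E3) :=
        Filter.eventuallyEq_of_mem (Metric.ball_mem_nhds x hρ) fun z hz => by
          show g z • bochnerField x W z = 0
          rw [hg0 z hz, zero_smul]
      have h0 : g x = 0 := hg0 x (Metric.mem_ball_self hρ)
      rw [h0, zero_mul]
      unfold VectorCalculus.divergence
      rw [hev.fderiv_eq, fderiv_const_apply]
      simp
    · have hQd : DifferentiableAt ℝ (bochnerField x₀ W) x :=
        (hQ.contDiffAt (isOpen_compl_singleton.mem_nhds hx)).differentiableAt one_ne_zero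
      rw [hV_def, divergence_smul_apply (hg.differentiable one_ne_zero x) hQd, hgrad x, real_inner_smul_right,
        inner_bochnerField_self (hW.differentiable (by norm_num) x) htan (sub_ne_zero.2 hx), mul_zero, add_zero]
  -- integrability of `div V` (continuous, compact support) and the pointwise inequality
  have hdivVc : Continuous (divergence V) := continuous_divergence (hV.continuous_fderiv one_ne_zero)
  have hdivV_supp : HasCompactSupport (divergence V) := by
    refine hVc.mono' ?_
    intro x hx
    contrapose! hx
    simp only [Function.mem_support, ne_eq, not_not]
    exact divergence_eq_zero_of_notMem_tsupport hx
  have hI1 : Integrable (fun x => g x * divergence (bochnerField x₀ W) x) := by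
    have e : (fun x => g x * divergence (bochnerField x₀ W) x) = divergence V := funext fun x => (hdivV x).symm
    rw [e]
    exact hdivVc.integrable_of_hasCompactSupport hdivV_supp
  -- the other two integrands: `g · (continuous off the centre)` is continuous with compact support
  have hWc : Continuous W := hW.continuous
  have hdivWc : Continuous (divergence W) := continuous_divergence (hW.continuous_fderiv (by norm_num))
  have hsupp_g : ∀ f : E3 → ℝ, HasCompactSupport fun x => g x * f x := by
    intro f
    refine HasCompactSupport.intro (isCompact_closedBall x₀ (|S| + 1)) fun x hx => ?_
    rw [Metric.mem_closedBall, dist_eq_norm, not_le] at hx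
    have h1 : 1 ≤ ‖x - x₀‖ := by linarith [abs_nonneg S]
    have hS' : S ≤ ‖x - x₀‖ ^ 2 := by nlinarith [le_abs_self S]
    show g x * f x = 0
    rw [hg_def]; dsimp only
    rw [hκS _ hS', zero_mul]
  have hc2 : Continuous fun x => g x * (‖W x‖ ^ 2 / ‖x - x₀‖ ^ 2) := by
    have hf : ContDiffOn ℝ 0 (fun x => ‖W x‖ ^ 2 / ‖x - x₀‖ ^ 2) {x₀}ᶜ := by
      rw [contDiffOn_zero]
      refine (hWc.norm.pow 2).continuousOn.div
        ((continuous_norm.comp (continuous_id.sub continuous_const)).pow 2).continuousOn fun x hx => ?_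
      exact pow_ne_zero 2 (norm_ne_zero_iff.2 (sub_ne_zero.2 hx))
    have h := contDiff_smul_of_vanishing (n := 0) (F := ℝ) hρ (hg.of_le (by norm_num)) hg0 hf
    exact contDiff_zero.1 h
  have hI2 : Integrable fun x => g x * (‖W x‖ ^ 2 / ‖x - x₀‖ ^ 2) :=
    hc2.integrable_of_hasCompactSupport (hsupp_g _)
  have hI3 : Integrable fun x => g x * divergence W x ^ 2 :=
    (hg.continuous.mul (hdivWc.pow 2)).integrable_of_hasCompactSupport (hsupp_g _)
  -- pointwise inequality, everywhere
  have hpt : ∀ x, g x * divergence (bochnerField x₀ W) x + g x * (‖W x‖ ^ 2 / ‖x - x₀‖ ^ 2) ≤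
      (1 / 2) * (g x * divergence W x ^ 2) := by
    intro x
    by_cases hx : x = x₀
    · subst hx
      rw [hg0 x (Metric.mem_ball_self hρ)]
      simp
    · have key := divergence_bochnerField_add_le hW.contDiffAt (sub_ne_zero.2 hx) htan (hcurl x hx)
      have hgx : 0 ≤ g x := hκnn _
      have := mul_le_mul_of_nonneg_left key hgx
      linarith [this]
  have hmono : ∫ x, (g x * divergence (bochnerField x₀ W) x + g x * (‖W x‖ ^ 2 / ‖x - x₀‖ ^ 2)) ≤
      ∫ x, (1 / 2) * (g x * divergence W x ^ 2) := integral_mono (hI1.add hI2) (hI3.const_mul (1 / 2)) hpt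
  rw [integral_add hI1 hI2, integral_const_mul] at hmono
  have e : ∫ x, g x * divergence (bochnerField x₀ W) x = 0 := by
    rw [show (fun x => g x * divergence (bochnerField x₀ W) x) = divergence V from funext fun x => (hdivV x).symm]
    exact hint0
  rw [e, zero_add] at hmono
  exact hmono


end Hodge

end Summit.NavierStokesRegularity.NavierStokesRegularity.Theorems.PoloidalLiouville.CentreVirial
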